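import Summits.Schanuel.Schanuel.Theses.RootDecomp1H
import Summits.Schanuel.Schanuel.Theorems.RootDecomp1HTowerCells
import Literature.NumberTheory.Transcendental.OneMotiveToric

/-!
# RootDecomp1HHull — the GLUE of round 6 of route RootDecomp1H («Hull», lens-5 cell decomp-schanuel): the TOWER HULL theorem

Proves the D-0019 glue item `BridgeCyclicGlue`:
`ProductSchanuel → RelTowerSchanuel → BridgeTransverse → BridgeCyclic`.

**The hull theorem** (`hull_of_product_of_relTower`).  Call `b : Fin N → ℂ` a (`ℚ`-free) TOWER tuple when every prefix field
`ℚ(b↾k, e^{b↾k})` has transcendence degree `≤ k`.  Under `ProductSchanuel ∧ RelTowerSchanuel` — which together say that Schanuel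
holds AT every `ℚ`-free tower tuple (`RootDecomp1HTowerCells.not_lt_of_towerSpan`) — Schanuel already holds at EVERY `ℚ`-free tuple
`y` lying in the `ℚ`-SPAN of a `ℚ`-free tower tuple of ANY length (the tower hull).  Proof = submodular descent along the prefix
flag, by induction on the length `N + 1` of `b` with prefix `b'`, `T' = span b'`, `V = span y` (`dim V = m + 1`): if `V ≤ T'`
induct; else `V ⊔ T' = span b` and `dim (V ⊓ T') = m`; a basis `u` of `V ⊓ T'` scaled into `span_ℤ y ∩ span_ℤ b'` has
`F_u = ℚ(u, eᵘ) ≤ ℚ(y, eʸ)` and `≤ L' = ℚ(b', e^{b'})`, and the induction hypothesis gives `trdeg F_u ≥ m`; the last vector of `b`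
scaled into `span_ℤ y + span_ℤ b'` gives a free tower `b̂` with `ℚ(b̂, e^{b̂}) ≤ P = ℚ(b', e^{b'}, y, eʸ)`, so
`N + 1 ≤ trdeg P = trdeg L' + trdeg_{L'} L'(y, eʸ) ≤ N + trdeg_{F_u} F_u(y, eʸ)` (tower law + base change); hence the last
term is `≥ 1` and `trdeg ℚ(y, eʸ) = trdeg F_u + trdeg_{F_u} F_u(y, eʸ) ≥ m + 1`.

**The glue.**  `BridgeTransverse` is `BridgeCS` with the extra hypothesis «`span_ℚ y` lies in the span of NO `ℚ`-free tower
tuple»; at a `BridgeCyclic` instance either that hypothesis holds (and `BridgeTransverse` answers) or the first failure lies in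
the tower hull, where the hull theorem forbids the counterexample outright.

Port of the lens-5 gen-6 node `HOME/decomp-schanuel-lens-5/g6/Hull.lean` §11 (`hullSchanuel_aux`, `bridgeCyclic_of_transverse`;
critic CLEARED 07:53:46Z; route round 6 typed revs 11–14, 07:59:11Z) over the RAW route texts, by the census seat (prover role):
the shim deleted (`BridgeTransverse` = stmt-Schanuel-30564 is a route constant since rev 11), the glue retyped on the item
`BridgeCyclicGlue` (stmt-Schanuel-30565), the monotonicity one-liner taken from `OneMotiveToric` instead of restated; this file
defines nothing; no transcendence input; 0 sorry.
-/

noncomputable section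

set_option linter.dupNamespace false
namespace Summit.Schanuel.Schanuel.Theorems.RootDecomp1HHull

open Complex Set
open Summit.Schanuel.Schanuel.Theses.RootDecomp1H
open Summit.Schanuel.Schanuel.Theorems.RootDecomp1HTowerCells (trdeg_adjoin_adjoin_eq adjoin_le_of_mem_span_int
  trdeg_le_of_mem_span_int linearIndependent_scaled)

variable {n : ℕ}

/-! ### Tools -/

/-- The generators of a prefix field are among the generators of the whole field. -/
theorem prefix_subset (b : Fin n → ℂ) {k : ℕ} (hk : k ≤ n) :
    range (b ∘ Fin.castLE hk) ∪ range (cexp ∘ (b ∘ Fin.castLE hk)) ⊆ range b ∪ range (cexp ∘ b) :=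
  Set.union_subset_union (Set.range_comp_subset_range _ _) (Set.range_comp_subset_range (Fin.castLE hk) (cexp ∘ b))

/-- Transport of a prefix bound along an equality of tuples (avoids rewriting under the binder). -/
theorem prefix_trdeg_le_of_eq {k : ℕ} {v v' : Fin k → ℂ} (h : v = v')
    (hle : Algebra.trdeg ℚ ↥(IntermediateField.adjoin ℚ (range v' ∪ range (cexp ∘ v'))) ≤ (k : Cardinal)) :
    Algebra.trdeg ℚ ↥(IntermediateField.adjoin ℚ (range v ∪ range (cexp ∘ v))) ≤ (k : Cardinal) := by
  subst h
  exact hle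

/-! ### The hull theorem -/

/-- **THE HULL THEOREM.**  Under `ProductSchanuel ∧ RelTowerSchanuel`, Schanuel holds at every `ℚ`-free tuple `y` inside the
`ℚ`-span of a `ℚ`-free tower tuple `b` (of any length `N`). -/
theorem hull_of_product_of_relTower (hPS : ProductSchanuel) (hRT : RelTowerSchanuel) :
    ∀ (N : ℕ) (b : Fin N → ℂ), LinearIndependent ℚ b →
      (∀ (k : ℕ) (hk : k ≤ N), Algebra.trdeg ℚ ↥(IntermediateField.adjoin ℚ (Set.range (b ∘ Fin.castLE hk) ∪ Set.range (Complex.exp ∘ (b ∘ Fin.castLE hk)))) ≤ (k : Cardinal)) →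
      ∀ (n : ℕ) (y : Fin n → ℂ), LinearIndependent ℚ y → (∀ j, y j ∈ Submodule.span ℚ (range b)) →
        (n : Cardinal) ≤ Algebra.trdeg ℚ ↥(IntermediateField.adjoin ℚ (range y ∪ range (cexp ∘ y))) := by
  intro N
  induction N with
  | zero =>
    intro b _ _ n y hy hmem
    cases n with
    | zero => simp
    | succ m =>
      exfalso
      have hbot : Submodule.span ℚ (range b) = ⊥ := by
        rw [Set.range_eq_empty b, Submodule.span_empty]
      have h0 : y 0 = 0 := by
        have h := hmem 0
        rw [hbot, Submodule.mem_bot] at h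
        exact h
      exact hy.ne_zero 0 h0
  | succ N ih =>
    intro b hb htow n y hy hmem
    classical
    -- the prefix tower `b'` and the three spans `T' = span b' ≤ T = span b ≥ V = span y`
    let b' : Fin N → ℂ := b ∘ Fin.castSucc
    have hb'li : LinearIndependent ℚ b' := hb.comp _ (Fin.castSucc_injective N)
    have hb'tow : (∀ (k : ℕ) (hk : k ≤ N), Algebra.trdeg ℚ ↥(IntermediateField.adjoin ℚ (Set.range (b' ∘ Fin.castLE hk) ∪ Set.range (Complex.exp ∘ (b' ∘ Fin.castLE hk)))) ≤ (k : Cardinal)) :=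
      fun k hk => htow k (hk.trans (Nat.le_succ N))
    set T' : Submodule ℚ ℂ := Submodule.span ℚ (range b') with hT'
    set T : Submodule ℚ ℂ := Submodule.span ℚ (range b) with hT
    set V : Submodule ℚ ℂ := Submodule.span ℚ (range y) with hV
    -- case `V ≤ T'`: the induction hypothesis
    by_cases hall : ∀ j, y j ∈ T'
    · exact ih b' hb'li hb'tow n y hy hall
    obtain ⟨j₀, hj₀⟩ := not_forall.mp hall
    obtain ⟨m, rfl⟩ : ∃ m, n = m + 1 := ⟨n - 1, by have := j₀.pos; omega⟩
    -- dimensions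
    haveI : FiniteDimensional ℚ V := FiniteDimensional.span_of_finite ℚ (finite_range y)
    haveI : FiniteDimensional ℚ T' := FiniteDimensional.span_of_finite ℚ (finite_range b')
    haveI : FiniteDimensional ℚ T := FiniteDimensional.span_of_finite ℚ (finite_range b)
    have hVn : Module.finrank ℚ V = m + 1 := by rw [hV, finrank_span_eq_card hy, Fintype.card_fin]
    have hT'N : Module.finrank ℚ T' = N := by rw [hT', finrank_span_eq_card hb'li, Fintype.card_fin]
    have hTN : Module.finrank ℚ T = N + 1 := by rw [hT, finrank_span_eq_card hb, Fintype.card_fin]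
    have hVT : V ≤ T := Submodule.span_le.mpr (Set.range_subset_iff.mpr hmem)
    have hT'T : T' ≤ T := by
      refine Submodule.span_mono ?_
      rintro _ ⟨i, rfl⟩
      exact ⟨Fin.castSucc i, rfl⟩
    haveI : FiniteDimensional ℚ ↥(V ⊓ T') := Submodule.finiteDimensional_of_le inf_le_left
    -- `V ⊔ T' = T` (`y j₀ ∉ T'`, a hyperplane of `T`) and `dim (V ⊓ T') = m`
    have hsup : V ⊔ T' = T := by
      refine Submodule.eq_of_le_of_finrank_le (sup_le hVT hT'T) ?_
      have hlt : T' < V ⊔ T' := SetLike.lt_iff_le_and_exists.mpr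
        ⟨le_sup_right, y j₀, Submodule.mem_sup_left (Submodule.subset_span ⟨j₀, rfl⟩), hj₀⟩
      have h := Submodule.finrank_lt_finrank_of_lt hlt
      rw [hT'N] at h
      rw [hTN]
      exact h
    have hdimU : Module.finrank ℚ ↥(V ⊓ T') = m := by
      have h := Submodule.finrank_sup_add_finrank_inf_eq V T'
      rw [hsup, hTN, hVn, hT'N] at h
      omega
    -- a basis `u` of `V ⊓ T'`, scaled into `span_ℤ y ∩ span_ℤ b'`
    let bU := Module.finBasisOfFinrankEq ℚ ↥(V ⊓ T') hdimU
    let u : Fin m → ℂ := fun i => (bU i : ℂ)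
    have hu_li : LinearIndependent ℚ u := bU.linearIndependent.map' (V ⊓ T').subtype (Submodule.ker_subtype _)
    have hu_mem : ∀ i, u i ∈ V ⊓ T' := fun i => (bU i).2
    choose N₁ hN₁ hN₁_mem using fun i =>
      Literature.NumberTheory.Transcendental.exists_nsmul_mem_span_int y (hu_mem i).1
    choose N₂ hN₂ hN₂_mem using fun i =>
      Literature.NumberTheory.Transcendental.exists_nsmul_mem_span_int b' (hu_mem i).2
    let u' : Fin m → ℂ := fun i => ((N₁ i * N₂ i : ℕ) : ℚ) • u i
    have hu'li : LinearIndependent ℚ u' :=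
      linearIndependent_scaled hu_li (fun i => N₁ i * N₂ i) fun i => mul_ne_zero (hN₁ i) (hN₂ i)
    have hu'_memy : ∀ i, u' i ∈ Submodule.span ℤ (range y) := by
      intro i
      have h : u' i = (N₂ i : ℚ) • ((N₁ i : ℚ) • u i) := by
        show ((N₁ i * N₂ i : ℕ) : ℚ) • u i = _
        rw [smul_smul, Nat.cast_mul, mul_comm]
      rw [h, Nat.cast_smul_eq_nsmul]
      exact nsmul_mem (hN₁_mem i) (N₂ i)
    have hu'_memb' : ∀ i, u' i ∈ Submodule.span ℤ (range b') := by
      intro i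
      have h : u' i = (N₁ i : ℚ) • ((N₂ i : ℚ) • u i) := by
        show ((N₁ i * N₂ i : ℕ) : ℚ) • u i = _
        rw [smul_smul, Nat.cast_mul]
      rw [h, Nat.cast_smul_eq_nsmul]
      exact nsmul_mem (hN₂_mem i) (N₁ i)
    have hu'_T' : ∀ i, u' i ∈ T' := fun i => T'.smul_mem _ (hu_mem i).2
    -- the induction hypothesis at `u' ⊂ span b'`
    have hm : (m : Cardinal) ≤ Algebra.trdeg ℚ ↥(IntermediateField.adjoin ℚ (range u' ∪ range (cexp ∘ u'))) :=
      ih b' hb'li hb'tow m u' hu'li hu'_T'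
    -- the last vector, scaled into `span_ℤ y + span_ℤ b'`
    have hlast : b (Fin.last N) ∈ V ⊔ T' := by
      rw [hsup]
      exact Submodule.subset_span ⟨Fin.last N, rfl⟩
    obtain ⟨v, hv, t, ht, hvt⟩ := Submodule.mem_sup.mp hlast
    obtain ⟨M₁, hM₁, hM₁_mem⟩ := Literature.NumberTheory.Transcendental.exists_nsmul_mem_span_int y hv
    obtain ⟨M₂, hM₂, hM₂_mem⟩ := Literature.NumberTheory.Transcendental.exists_nsmul_mem_span_int b' ht
    have hM : M₁ * M₂ ≠ 0 := mul_ne_zero hM₁ hM₂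
    let w : ℂ := ((M₁ * M₂ : ℕ) : ℚ) • b (Fin.last N)
    have hw_eq : w = (M₂ : ℚ) • ((M₁ : ℚ) • v) + (M₁ : ℚ) • ((M₂ : ℚ) • t) := by
      show ((M₁ * M₂ : ℕ) : ℚ) • b (Fin.last N) = _
      rw [← hvt, smul_add, smul_smul, smul_smul, Nat.cast_mul, mul_comm (M₂ : ℚ) (M₁ : ℚ)]
    have hwy : (M₂ : ℚ) • ((M₁ : ℚ) • v) ∈ Submodule.span ℤ (range y) := by
      rw [Nat.cast_smul_eq_nsmul]
      exact nsmul_mem hM₁_mem M₂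
    have hwb' : (M₁ : ℚ) • ((M₂ : ℚ) • t) ∈ Submodule.span ℤ (range b') := by
      rw [Nat.cast_smul_eq_nsmul]
      exact nsmul_mem hM₂_mem M₁
    -- the fields `F_u ≤ F_y`, `F_u ≤ L'`, `P = ℚ(b', e^{b'}, y, e^y)`
    set Sy : Set ℂ := range y ∪ range (cexp ∘ y) with hSy
    set Sb' : Set ℂ := range b' ∪ range (cexp ∘ b') with hSb'
    set Su : Set ℂ := range u' ∪ range (cexp ∘ u') with hSu
    set Fy : IntermediateField ℚ ℂ := IntermediateField.adjoin ℚ Sy with hFy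
    set L' : IntermediateField ℚ ℂ := IntermediateField.adjoin ℚ Sb' with hL'
    set Fu : IntermediateField ℚ ℂ := IntermediateField.adjoin ℚ Su with hFu
    set P : IntermediateField ℚ ℂ := IntermediateField.adjoin ℚ (Sb' ∪ Sy) with hP
    have hFuFy : Fu ≤ Fy := adjoin_le_of_mem_span_int y u' hu'_memy
    have hFuL' : Fu ≤ L' := adjoin_le_of_mem_span_int b' u' hu'_memb'
    have hFyP : Fy ≤ P := IntermediateField.adjoin.mono ℚ _ _ Set.subset_union_right
    have hL'P : L' ≤ P := IntermediateField.adjoin.mono ℚ _ _ Set.subset_union_left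
    have hwP : w ∈ P ∧ cexp w ∈ P := by
      have h₁ := Literature.NumberTheory.Transcendental.mem_adjoin_of_mem_span_int y hwy
      have h₂ := Literature.NumberTheory.Transcendental.mem_adjoin_of_mem_span_int b' hwb'
      refine ⟨?_, ?_⟩
      · rw [hw_eq]
        exact add_mem (hFyP h₁.1) (hL'P h₂.1)
      · rw [hw_eq, Complex.exp_add]
        exact mul_mem (hFyP h₁.2) (hL'P h₂.2)
    -- the rescaled tower `bs = (b', w)`: free, a tower, and `ℚ(bs, e^{bs}) ≤ P`
    let c : Fin (N + 1) → ℕ := fun i => if i = Fin.last N then M₁ * M₂ else 1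
    have hc : ∀ i, c i ≠ 0 := by
      intro i
      by_cases hi : i = Fin.last N
      · simp only [c, if_pos hi]; exact hM
      · simp only [c, if_neg hi]; exact one_ne_zero
    let bs : Fin (N + 1) → ℂ := fun i => (c i : ℚ) • b i
    have hbs_li : LinearIndependent ℚ bs := linearIndependent_scaled hb c hc
    have hbs_castSucc : ∀ i : Fin N, bs (Fin.castSucc i) = b' i := by
      intro i
      have hci : c (Fin.castSucc i) = 1 := if_neg (Fin.castSucc_lt_last i).ne
      show (c (Fin.castSucc i) : ℚ) • b (Fin.castSucc i) = b (Fin.castSucc i)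
      rw [hci, Nat.cast_one, one_smul]
    have hbs_last : bs (Fin.last N) = w := by
      have hcl : c (Fin.last N) = M₁ * M₂ := if_pos rfl
      show (c (Fin.last N) : ℚ) • b (Fin.last N) = ((M₁ * M₂ : ℕ) : ℚ) • b (Fin.last N)
      rw [hcl]
    have hbs_tow : (∀ (k : ℕ) (hk : k ≤ (N + 1)), Algebra.trdeg ℚ ↥(IntermediateField.adjoin ℚ (Set.range (bs ∘ Fin.castLE hk) ∪ Set.range (Complex.exp ∘ (bs ∘ Fin.castLE hk)))) ≤ (k : Cardinal)) := by
      intro k hk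
      rcases Nat.lt_or_ge k (N + 1) with hkN | hkN
      · -- a proper prefix of `bs` is the corresponding prefix of `b'`
        have hkN' : k ≤ N := Nat.lt_succ_iff.mp hkN
        have heq : bs ∘ Fin.castLE hk = b' ∘ Fin.castLE hkN' := by
          funext i
          show bs (Fin.castLE hk i) = b' (Fin.castLE hkN' i)
          have hi : Fin.castLE hk i = Fin.castSucc (Fin.castLE hkN' i) := Fin.ext rfl
          rw [hi, hbs_castSucc]
        exact prefix_trdeg_le_of_eq heq (hb'tow k hkN')
      · -- the whole tuple: `ℚ(bs, e^{bs}) ≤ ℚ(b, e^b)` has transcendence degree `≤ N + 1`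
        obtain rfl : k = N + 1 := le_antisymm hk hkN
        have hmemb : ∀ i, bs i ∈ Submodule.span ℤ (range b) := by
          intro i
          show (c i : ℚ) • b i ∈ Submodule.span ℤ (range b)
          rw [Nat.cast_smul_eq_nsmul]
          exact nsmul_mem (Submodule.subset_span (Set.mem_range_self i)) (c i)
        calc Algebra.trdeg ℚ ↥(IntermediateField.adjoin ℚ (range (bs ∘ Fin.castLE hk) ∪ range (cexp ∘ (bs ∘ Fin.castLE hk))))
            ≤ Algebra.trdeg ℚ ↥(IntermediateField.adjoin ℚ (range bs ∪ range (cexp ∘ bs))) :=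
              (Literature.NumberTheory.Transcendental.OneMotiveToric.trdeg_mono
                (IntermediateField.adjoin.mono ℚ _ _ (prefix_subset bs hk)))
          _ ≤ Algebra.trdeg ℚ ↥(IntermediateField.adjoin ℚ (range b ∪ range (cexp ∘ b))) :=
              trdeg_le_of_mem_span_int b bs hmemb
          _ ≤ ((N + 1 : ℕ) : Cardinal) :=
              htow (N + 1) le_rfl
    have hTSbs : ((N + 1 : ℕ) : Cardinal) ≤ Algebra.trdeg ℚ ↥(IntermediateField.adjoin ℚ (range bs ∪ range (cexp ∘ bs))) :=
      hRT (N + 1) bs hbs_tow hbs_li (fun m u hdep hu _ => hPS m u hdep hu)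
    have hbsP : IntermediateField.adjoin ℚ (range bs ∪ range (cexp ∘ bs)) ≤ P := by
      rw [IntermediateField.adjoin_le_iff]
      rintro a (⟨i, rfl⟩ | ⟨i, rfl⟩)
      · rcases Fin.eq_castSucc_or_eq_last i with ⟨j, rfl⟩ | rfl
        · rw [hbs_castSucc]
          exact hL'P (IntermediateField.subset_adjoin ℚ _ (Or.inl ⟨j, rfl⟩))
        · rw [hbs_last]
          exact hwP.1
      · rcases Fin.eq_castSucc_or_eq_last i with ⟨j, rfl⟩ | rfl
        · show cexp (bs (Fin.castSucc j)) ∈ P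
          rw [hbs_castSucc]
          exact hL'P (IntermediateField.subset_adjoin ℚ _ (Or.inr ⟨j, rfl⟩))
        · show cexp (bs (Fin.last N)) ∈ P
          rw [hbs_last]
          exact hwP.2
    -- the count
    have hP_ge : ((N + 1 : ℕ) : Cardinal) ≤ Algebra.trdeg ℚ P :=
      hTSbs.trans (trdeg_le_of_injective (IntermediateField.inclusion hbsP) (IntermediateField.inclusion_injective hbsP))
    have hL'_le : Algebra.trdeg ℚ L' ≤ (N : Cardinal) := hb'tow N le_rfl
    have htowerP : Algebra.trdeg ℚ L' + Algebra.trdeg L' (IntermediateField.adjoin L' Sy) = Algebra.trdeg ℚ P :=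
      trdeg_adjoin_adjoin_eq (K := ℚ) Sb' Sy
    have hbase : Algebra.trdeg L' (IntermediateField.adjoin L' Sy) ≤ Algebra.trdeg Fu (IntermediateField.adjoin Fu Sy) :=
      Literature.NumberTheory.Transcendental.trdeg_adjoin_le_of_le hFuL' Sy
    have htowerY : Algebra.trdeg ℚ Fu + Algebra.trdeg Fu (IntermediateField.adjoin Fu Sy) = Algebra.trdeg ℚ Fy := by
      have h3 : IntermediateField.adjoin ℚ (Su ∪ Sy) = Fy := by
        apply le_antisymm
        · rw [IntermediateField.adjoin_le_iff]
          rintro a (ha | ha)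
          · exact hFuFy (IntermediateField.subset_adjoin ℚ _ ha)
          · exact IntermediateField.subset_adjoin ℚ _ ha
        · exact IntermediateField.adjoin.mono ℚ _ _ Set.subset_union_right
      have h12 := trdeg_adjoin_adjoin_eq (K := ℚ) Su Sy
      rw [h3] at h12
      exact h12
    -- `1 ≤ trdeg_{F_u} F_u(y, e^y)`: else `N + 1 ≤ trdeg P = trdeg L' ≤ N`
    have hone : (1 : Cardinal) ≤ Algebra.trdeg Fu (IntermediateField.adjoin Fu Sy) := by
      rw [Cardinal.one_le_iff_ne_zero]
      intro h0
      have hb0 : Algebra.trdeg L' (IntermediateField.adjoin L' Sy) = 0 :=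
        nonpos_iff_eq_zero.mp (hbase.trans h0.le)
      have habs : ((N + 1 : ℕ) : Cardinal) ≤ (N : Cardinal) :=
        calc ((N + 1 : ℕ) : Cardinal) ≤ Algebra.trdeg ℚ P := hP_ge
          _ = Algebra.trdeg ℚ L' + Algebra.trdeg L' (IntermediateField.adjoin L' Sy) := htowerP.symm
          _ = Algebra.trdeg ℚ L' := by rw [hb0, add_zero]
          _ ≤ (N : Cardinal) := hL'_le
      norm_cast at habs
      omega
    calc ((m + 1 : ℕ) : Cardinal) = (m : Cardinal) + 1 := Nat.cast_succ m
      _ ≤ Algebra.trdeg ℚ Fu + Algebra.trdeg Fu (IntermediateField.adjoin Fu Sy) := add_le_add hm hone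
      _ = Algebra.trdeg ℚ Fy := htowerY

/-- Hence no `ℚ`-free tuple of the tower hull is a counterexample. -/
theorem not_lt_of_inTowerHull (hPS : ProductSchanuel) (hRT : RelTowerSchanuel) {y : Fin n → ℂ}
    (hli : LinearIndependent ℚ y)
    (hh : ∃ (N : ℕ) (b : Fin N → ℂ), LinearIndependent ℚ b ∧
      (∀ (k : ℕ) (hk : k ≤ N), Algebra.trdeg ℚ ↥(IntermediateField.adjoin ℚ (Set.range (b ∘ Fin.castLE hk) ∪ Set.range (Complex.exp ∘ (b ∘ Fin.castLE hk)))) ≤ (k : Cardinal)) ∧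
      ∀ j, y j ∈ Submodule.span ℚ (Set.range b)) :
    ¬ Algebra.trdeg ℚ ↥(IntermediateField.adjoin ℚ (range y ∪ range (cexp ∘ y))) < (n : Cardinal) := by
  obtain ⟨N, b, hb, htow, hmem⟩ := hh
  exact not_lt.2 (hull_of_product_of_relTower hPS hRT N b hb htow n y hli hmem)

/-! ### The glue -/

/-- **Item stmt-Schanuel-30565 (GLUE of round 6)**: `ProductSchanuel → RelTowerSchanuel → BridgeTransverse → BridgeCyclic` — at a
`BridgeCyclic` instance either the first failure lies in the tower hull (forbidden outright by the hull theorem) or it is transverse. -/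
theorem bridgeCyclicGlue_holds : BridgeCyclicGlue := by
  intro hPS hRT hT n c hlow y hopt hcs hce _ _ _
  by_cases hh : ∃ (N : ℕ) (b : Fin N → ℂ), LinearIndependent ℚ b ∧
      (∀ (k : ℕ) (hk : k ≤ N), Algebra.trdeg ℚ ↥(IntermediateField.adjoin ℚ (Set.range (b ∘ Fin.castLE hk) ∪ Set.range (Complex.exp ∘ (b ∘ Fin.castLE hk)))) ≤ (k : Cardinal)) ∧
      ∀ j, y j ∈ Submodule.span ℚ (Set.range b)
  · exact absurd hce.2 (not_lt_of_inTowerHull hPS hRT hce.1 hh)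
  · exact hT n c hlow y hopt hcs hce hh

end Summit.Schanuel.Schanuel.Theorems.RootDecomp1HHull
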